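import Summits.NavierStokesRegularity.FunctionalMining.MonomialBudgetRefutation
import Summits.NavierStokesRegularity.FunctionalMining.ThreeWaveWitness
import Summits.NavierStokesRegularity.FunctionalMining.NoGo.BudgetedSieves
import HarnessLib

/-!
# Functional mining, NO-GO: the budgeted sieves ALONG NAVIER–STOKES on `T³` (theorem N1 wired
# to smooth local existence)

Search for candidate a priori estimates; no regularity claim.

Cell `pub-nsfunc` (host summit NavierStokesRegularity, topic `FunctionalMining`), no-go branch
(`HOME/NOGO.md` §1 theorem N1, §4 row T3). `NoGo/BudgetedSieves.lean` proves the budgeted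
amplitude/parity sieve and its critical-degree companion ABSTRACTLY, for a rate inequality
`ν V − I ≤ Θ` on a data class `P ⊆ X` stable under amplitude scaling and the sign flip; its only
instance in the tree so far is the Galerkin truncation (`NoGo/GalerkinReduction.lean`,
`NoGo/GalerkinWitness.lean`), whose dynamics is globally soluble. This file runs the two sieves at
PDE LEVEL, along the zero-mean classical solutions of the unforced Navier–Stokes system on the unit
3-torus — the setting of the census template `IsRateBudget` (`RateBudgets.lean`) — by composing
them with the dynamic reduction `initialRate_le_of_isRateBudget`, which carries the tree's smooth
local existence theorem `Torus.exists_classicalNS_smooth` (`FluidPDE/TorusNSSmoothLocalExistence`):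
a budget along EVERY solution restricts the initial rate at EVERY smooth divergence-free zero-mean
datum, and that data class is stable under `u ↦ A • u` and `u ↦ −u`. All PROVED (no named fact is
assumed); nothing of the imported files is re-proved.

* `inertialRate_eq_zero_of_isRateBudget_subcritical` — **theorem N1 along Navier–Stokes.** Let
  `F` have initial rates `(N, V)` (`HasInitialRate F N V`: one-sided derivative `N u₀ + ν V u₀`
  at the initial time), `V` even and amplitude-homogeneous of degree `m` on smooth fields, `N` odd
  and homogeneous of degree `m + 1`. If `F` obeys a rate budget `B` (`IsRateBudget F B`) whose
  value at some viscosity `ν > 0` grows at most like `A^q`, `q < m + 1`, along the amplitude ray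
  `A ≥ 1` of every smooth divergence-free zero-mean field, then `N ≡ 0` on that class: `F` is a
  formal invariant of the Euler dynamics on `T³`. No concentration, no scaling: one amplitude ray
  and one sign flip per datum.
* `inertialRate_le_of_isRateBudget_critical` — **escape door D2 along Navier–Stokes.** If instead
  `B ν (A • u) ≤ A^(m+1) · Btop u + C_u · A^q`, `q < m + 1` (critical amplitude degree, top part
  `Btop`), then `N u ≤ Btop u` at every smooth divergence-free zero-mean `u`: viscosity drops out
  and the census row is equivalent-in-strength to a STATIC functional inequality on data (one-sided,
  no parity needed).
* The enstrophy `ℰ = ½‖∇u‖₂²` (`N = enstrophyProduction = ∫⟪(u·∇)u, Δu⟫` cubic and odd,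
  `V = −∫‖Δu‖²` quadratic and even: `torusEnstrophy_hasInitialRate`, `QuadraticBudgetStatic`;
  here `enstrophyViscousRate_amp`, `enstrophyViscousRate_neg`, `enstrophyProduction_amp`):
  `enstrophyProduction_eq_zero_of_isRateBudget_subcubic` (every budget of two-sided sub-cubic
  amplitude growth forces `σ ≡ 0` on the class), `not_isRateBudget_torusEnstrophy_subcubic`
  (**NO-GO on `T³ = (Fin 3 → ℝ)/ℤ³`**: the three-wave field of `ThreeWaveWitness.lean`,
  production `16π³ ≠ 0`, refutes EVERY such budget — whatever its shape and its Navier–Stokes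
  scaling degree), `monomialBudget_const_smul` + `not_isRateBudget_torusEnstrophy_monomial_amp`
  (the monomial instance: `C(ν) K^a ℰ^b D^e` fails for all real `a, b, e` with `a + b + e < 3/2`
  and every `C(ν)` — a half-space NOT contained in the scaling-subcritical one `b − a + 3e < 3` of
  `MonomialBudgetRefutation.lean`; the monomial class is thereby decided outside the wedge
  `{b − a + 3e ≥ 3} ∩ {a + b + e ≥ 3/2}`), and `enstrophyProduction_le_of_isRateBudget_cubic`
  (a budget of cubic amplitude growth with top part `Btop` holds only if `σ(u) ≤ Btop(u)` for
  every admissible `u`: door D2 for `ℰ`).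

Scope, exactly: the hypotheses are on the growth of `u ↦ B ν (A • u)` for ONE `ν > 0` along the
amplitude rays of smooth divergence-free zero-mean fields (both signs for N1); nothing is said about
budgets of super-critical amplitude degree, about time-integrated or threshold templates, or about
`ℝ³`. This is the "N1-to-LWP wiring" of the ladder file (`ladders/NS.md`, rung N6e): THEOREM N1 of
`HOME/NOGO.md` is no longer "modulo smooth local existence (in-tree, unwired)".
FILING (prove seat g34, REQUEST #131): declarations byte-identical to the no-go seat's staged `BudgetedSievesNS.STAGING.lean` 162b4a32f5137a4a; this line is the only addition.
-/

noncomputable section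

open MeasureTheory
open scoped RealInnerProductSpace

namespace Summit.NavierStokesRegularity.FunctionalMining

open Literature.Analysis.FunctionSpaces Literature.Analysis.FunctionSpaces.Torus
  Literature.Analysis.FluidPDE

variable {d : Type*} [Fintype d] [DecidableEq d]

/-! ## Theorem N1 and door D2 along Navier–Stokes on `T³` (any functional with initial rates) -/

/-- **Budgeted amplitude/parity sieve along Navier–Stokes (theorem N1, PDE level).** Let `F` have
initial rates `(N, V)` along the zero-mean classical solutions of unforced Navier–Stokes on `T³`,
with `V` even and homogeneous of degree `m` and `N` odd and homogeneous of degree `m + 1` on smooth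
fields (`A > 0`). If `F` obeys a rate budget `B` along every solution and, for some `ν > 0`,
`B ν (A • u) ≤ C_u · A^q` for all `A ≥ 1` at every smooth divergence-free zero-mean `u`, with
`q < m + 1`, then `N u₀ = 0` at every smooth divergence-free zero-mean `u₀`. Proof: the dynamic
reduction `initialRate_le_of_isRateBudget` (smooth local existence on `T³`, persistence of the zero
mean, uniqueness of one-sided derivatives) gives `N + ν V ≤ B ν` on the data class, which is
stable under `u ↦ A • u` and `u ↦ −u`; then `inertial_eq_zero_of_rate_le` (`NoGo/BudgetedSieves`)
with `I = −N`. [folklore] -/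
theorem inertialRate_eq_zero_of_isRateBudget_subcritical
    {F : (UnitAddTorus d → EuclideanSpace ℝ d) → ℝ}
    {N V : (UnitAddTorus d → EuclideanSpace ℝ d) → ℝ}
    {B : ℝ → (UnitAddTorus d → EuclideanSpace ℝ d) → ℝ} {m q : ℝ}
    (hB : IsRateBudget F B) (hNV : HasInitialRate F N V) (hd : Fintype.card d = 3)
    (hV_amp : ∀ (A : ℝ) (u : UnitAddTorus d → EuclideanSpace ℝ d), 0 < A → IsSmooth u →
      V (A • u) = A ^ m * V u)
    (hN_amp : ∀ (A : ℝ) (u : UnitAddTorus d → EuclideanSpace ℝ d), 0 < A → IsSmooth u →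
      N (A • u) = A ^ (m + 1) * N u)
    (hV_neg : ∀ u : UnitAddTorus d → EuclideanSpace ℝ d, IsSmooth u → V (-u) = V u)
    (hN_neg : ∀ u : UnitAddTorus d → EuclideanSpace ℝ d, IsSmooth u → N (-u) = -N u)
    {ν : ℝ} (hν : 0 < ν)
    (hBq : ∀ u : UnitAddTorus d → EuclideanSpace ℝ d, IsSmooth u → IsDivFree u → HasZeroMean u →
      ∃ C : ℝ, ∀ A : ℝ, 1 ≤ A → B ν (A • u) ≤ C * A ^ q)
    (hq : q < m + 1) {u₀ : UnitAddTorus d → EuclideanSpace ℝ d} (hu₀ : IsSmooth u₀)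
    (hdiv : IsDivFree u₀) (hmean : HasZeroMean u₀) : N u₀ = 0 := by
  -- the admissible data class, as a type
  let X := {u : UnitAddTorus d → EuclideanSpace ℝ d // IsSmooth u ∧ IsDivFree u ∧ HasZeroMean u}
  have hX1 : ∀ x : X, IsContDiff 1 x.1 := fun x => x.2.1.isContDiff (by exact_mod_cast le_top)
  let amp : ℝ → X → X := fun A x =>
    ⟨A • x.1, x.2.1.smul A, isDivFree_const_smul (hX1 x) x.2.2.1 A,
      hasZeroMean_const_smul x.2.2.2 A⟩
  let neg : X → X := fun x => ⟨-x.1, x.2.1.neg, isDivFree_neg x.2.2.1, hasZeroMean_neg x.2.2.2⟩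
  have key : ∀ x : X, True → (fun x : X => -N x.1) x = 0 :=
    inertial_eq_zero_of_rate_le (P := fun _ : X => True) (amp := amp) (neg := neg)
      (V := fun x : X => V x.1) (I := fun x : X => -N x.1) (Θ := fun x : X => B ν x.1)
      (ν := ν) (m := m) (q := q)
      (fun _ _ _ _ => trivial) (fun _ _ => trivial)
      (fun A x hA => hV_amp A x.1 hA x.2.1)
      (fun A x hA => by
        show -N (A • x.1) = A ^ (m + 1) * -N x.1
        rw [hN_amp A x.1 hA x.2.1]
        ring)
      (fun x => hV_neg x.1 x.2.1)
      (fun x => by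
        show -N (-x.1) = -(-N x.1)
        rw [hN_neg x.1 x.2.1])
      (fun x _ => hBq x.1 x.2.1 x.2.2.1 x.2.2.2) hq
      (fun x _ => by
        have h := initialRate_le_of_isRateBudget hB hNV hd hν x.2.1 x.2.2.1 x.2.2.2
        show ν * V x.1 - -N x.1 ≤ B ν x.1
        linarith)
  have h0 := key ⟨u₀, hu₀, hdiv, hmean⟩ trivial
  simpa using h0

/-- **Critical amplitude degree along Navier–Stokes (escape door D2, PDE level).** Same setting,
one-sided and without parity: if for some `ν > 0` the budget grows along the amplitude ray of every
smooth divergence-free zero-mean `u` at most like `A^(m+1) · Btop u + C_u · A^q`, `q < m + 1`, then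
`N u₀ ≤ Btop u₀` at every smooth divergence-free zero-mean `u₀` — viscosity has dropped out: a
budget of the critical amplitude degree closes only if its top-degree part alone dominates the
Euler production of `F`, datum by datum (a static functional inequality). Proof: the dynamic
reduction and `neg_inertial_le_of_rate_le_critical` with `I = −N`. [folklore] -/
theorem inertialRate_le_of_isRateBudget_critical
    {F : (UnitAddTorus d → EuclideanSpace ℝ d) → ℝ}
    {N V : (UnitAddTorus d → EuclideanSpace ℝ d) → ℝ}
    {B : ℝ → (UnitAddTorus d → EuclideanSpace ℝ d) → ℝ}
    {Btop : (UnitAddTorus d → EuclideanSpace ℝ d) → ℝ} {m q : ℝ}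
    (hB : IsRateBudget F B) (hNV : HasInitialRate F N V) (hd : Fintype.card d = 3)
    (hV_amp : ∀ (A : ℝ) (u : UnitAddTorus d → EuclideanSpace ℝ d), 0 < A → IsSmooth u →
      V (A • u) = A ^ m * V u)
    (hN_amp : ∀ (A : ℝ) (u : UnitAddTorus d → EuclideanSpace ℝ d), 0 < A → IsSmooth u →
      N (A • u) = A ^ (m + 1) * N u)
    {ν : ℝ} (hν : 0 < ν)
    (hBq : ∀ u : UnitAddTorus d → EuclideanSpace ℝ d, IsSmooth u → IsDivFree u → HasZeroMean u →
      ∃ C : ℝ, ∀ A : ℝ, 1 ≤ A → B ν (A • u) ≤ A ^ (m + 1) * Btop u + C * A ^ q)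
    (hq : q < m + 1) {u₀ : UnitAddTorus d → EuclideanSpace ℝ d} (hu₀ : IsSmooth u₀)
    (hdiv : IsDivFree u₀) (hmean : HasZeroMean u₀) : N u₀ ≤ Btop u₀ := by
  let X := {u : UnitAddTorus d → EuclideanSpace ℝ d // IsSmooth u ∧ IsDivFree u ∧ HasZeroMean u}
  have hX1 : ∀ x : X, IsContDiff 1 x.1 := fun x => x.2.1.isContDiff (by exact_mod_cast le_top)
  let amp : ℝ → X → X := fun A x =>
    ⟨A • x.1, x.2.1.smul A, isDivFree_const_smul (hX1 x) x.2.2.1 A,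
      hasZeroMean_const_smul x.2.2.2 A⟩
  have key : ∀ x : X, True → -(fun x : X => -N x.1) x ≤ (fun x : X => Btop x.1) x :=
    neg_inertial_le_of_rate_le_critical (P := fun _ : X => True) (amp := amp)
      (V := fun x : X => V x.1) (I := fun x : X => -N x.1) (Θ := fun x : X => B ν x.1)
      (Θtop := fun x : X => Btop x.1) (ν := ν) (m := m) (q := q)
      (fun _ _ _ _ => trivial)
      (fun A x hA => hV_amp A x.1 hA x.2.1)
      (fun A x hA => by
        show -N (A • x.1) = A ^ (m + 1) * -N x.1
        rw [hN_amp A x.1 hA x.2.1]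
        ring)
      (fun x _ => hBq x.1 x.2.1 x.2.2.1 x.2.2.2) hq
      (fun x _ => by
        have h := initialRate_le_of_isRateBudget hB hNV hd hν x.2.1 x.2.2.1 x.2.2.2
        show ν * V x.1 - -N x.1 ≤ B ν x.1
        linarith)
  have h0 := key ⟨u₀, hu₀, hdiv, hmean⟩ trivial
  simpa using h0

/-! ## The enstrophy instance: every budget of sub-cubic amplitude growth fails on `T³` -/

omit [DecidableEq d] in
/-- The viscous rate of the enstrophy, `V(u) = −∫‖Δu‖²`, is quadratic along amplitude rays
(`laplacianNormSq_const_smul`), in the real-exponent form used by the sieves. [folklore] -/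
theorem enstrophyViscousRate_amp {u : UnitAddTorus d → EuclideanSpace ℝ d} (hu : IsSmooth u)
    (A : ℝ) : (-∫ x, ‖Torus.laplacian (A • u) x‖ ^ 2) =
      A ^ (2 : ℝ) * -∫ x, ‖Torus.laplacian u x‖ ^ 2 := by
  rw [laplacianNormSq_const_smul hu A, Real.rpow_two]
  ring

omit [DecidableEq d] in
/-- The viscous rate of the enstrophy is even: `∫‖Δ(−u)‖² = ∫‖Δu‖²` for smooth `u`. [folklore] -/
theorem enstrophyViscousRate_neg {u : UnitAddTorus d → EuclideanSpace ℝ d} (hu : IsSmooth u) :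
    (-∫ x, ‖Torus.laplacian (-u) x‖ ^ 2) = -∫ x, ‖Torus.laplacian u x‖ ^ 2 := by
  congr 1
  refine integral_congr_ae (ae_of_all _ fun x => ?_)
  dsimp only
  rw [Torus.laplacian_neg_apply hu x, norm_neg]

omit [DecidableEq d] in
/-- The enstrophy production is cubic along amplitude rays (`enstrophyProduction_const_smul`), in
the real-exponent form used by the sieves. [folklore] -/
theorem enstrophyProduction_amp {u : UnitAddTorus d → EuclideanSpace ℝ d} (hu : IsSmooth u)
    (A : ℝ) : enstrophyProduction (A • u) = A ^ ((2 : ℝ) + 1) * enstrophyProduction u := by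
  rw [enstrophyProduction_const_smul hu A, show (2 : ℝ) + 1 = ((3 : ℕ) : ℝ) by norm_num,
    Real.rpow_natCast]

/-- **Every sub-cubic budget makes the enstrophy a formal Euler invariant.** If `ℰ = ½‖∇u‖₂²`
obeys a rate budget `B` along every zero-mean classical solution of unforced Navier–Stokes on `T³`
and, for some `ν > 0`, `B ν (A • u) ≤ C_u · A^q` (`A ≥ 1`) at every smooth divergence-free
zero-mean `u` with `q < 3`, then the enstrophy production `σ = ∫⟪(u·∇)u, Δu⟫` vanishes at every
smooth divergence-free zero-mean field (theorem N1 with `m = 2`: `σ` cubic and odd, `∫‖Δu‖²`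
quadratic and even). [folklore] -/
theorem enstrophyProduction_eq_zero_of_isRateBudget_subcubic (hd : Fintype.card d = 3)
    {B : ℝ → (UnitAddTorus d → EuclideanSpace ℝ d) → ℝ} {q : ℝ}
    (hB : IsRateBudget (d := d) torusEnstrophy B) {ν : ℝ} (hν : 0 < ν)
    (hBq : ∀ u : UnitAddTorus d → EuclideanSpace ℝ d, IsSmooth u → IsDivFree u → HasZeroMean u →
      ∃ C : ℝ, ∀ A : ℝ, 1 ≤ A → B ν (A • u) ≤ C * A ^ q)
    (hq : q < 3) {u₀ : UnitAddTorus d → EuclideanSpace ℝ d} (hu₀ : IsSmooth u₀)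
    (hdiv : IsDivFree u₀) (hmean : HasZeroMean u₀) : enstrophyProduction u₀ = 0 :=
  inertialRate_eq_zero_of_isRateBudget_subcritical (m := 2) (q := q) hB
    torusEnstrophy_hasInitialRate hd
    (fun A u _ hu => enstrophyViscousRate_amp hu A) (fun A u _ hu => enstrophyProduction_amp hu A)
    (fun u hu => enstrophyViscousRate_neg hu)
    (fun u hu => enstrophyProduction_neg hu) hν hBq (by norm_num; exact hq) hu₀ hdiv hmean

open ThreeWaveTorus in
/-- **NO-GO: no rate budget of sub-cubic amplitude growth for the enstrophy on `T³`.** For every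
budget `B` such that, for some `ν > 0`, `B ν (A • u) ≤ C_u · A^q` for all `A ≥ 1` at every smooth
divergence-free zero-mean field `u` on the unit 3-torus, with `q < 3`, the census row
"`dℰ/dt ≤ B ν (u)` along every zero-mean classical solution of unforced Navier–Stokes" is FALSE:
the three-wave field `w = (2cos 2πy, 0, 2cos 2πx + 2sin 2π(x+y))` of `ThreeWaveWitness.lean` is
smooth, divergence-free and zero-mean with production `16π³ ≠ 0`. Examples: `C(ν) K^a ℰ^b D^e`
(`K` kinetic energy, `D = ∫‖Δu‖²`) for all real `a, b, e` with `a + b + e < 3/2`, and every budget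
dominated along amplitude rays by such growth; in particular budgets of any Navier–Stokes scaling
degree (e.g. `ℰ³/K²`, scaling degree `5`), which the scaling sieve does not see. Search for
candidate a priori estimates; no regularity claim. [folklore] -/
theorem not_isRateBudget_torusEnstrophy_subcubic
    {B : ℝ → (UnitAddTorus (Fin 3) → EuclideanSpace ℝ (Fin 3)) → ℝ} {q ν : ℝ} (hν : 0 < ν)
    (hBq : ∀ u : UnitAddTorus (Fin 3) → EuclideanSpace ℝ (Fin 3), IsSmooth u → IsDivFree u →
      HasZeroMean u → ∃ C : ℝ, ∀ A : ℝ, 1 ≤ A → B ν (A • u) ≤ C * A ^ q)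
    (hq : q < 3) : ¬ IsRateBudget (d := Fin 3) torusEnstrophy B := fun hB => by
  have h0 := enstrophyProduction_eq_zero_of_isRateBudget_subcubic (Fintype.card_fin 3) hB hν hBq
    hq isSmooth_w isDivFree_w hasZeroMean_w
  rw [enstrophyProduction_threeWave] at h0
  have : (0 : ℝ) < 16 * Real.pi ^ 3 := by positivity
  exact this.ne' h0

/-- Along amplitude rays a monomial `K^a ℰ^b D^e` (`K = ½‖u‖₂²`, `ℰ = ½‖∇u‖₂²`, `D = ∫‖Δu‖²`,
real powers) has degree `2(a + b + e)`: the three gauges are quadratic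
(`kineticEnergy_const_smul`, `torusEnstrophy_const_smul`, `laplacianNormSq_const_smul`) and
non-negative. [folklore] -/
theorem monomialBudget_const_smul {u : UnitAddTorus d → EuclideanSpace ℝ d} (hu : IsSmooth u)
    (a b e : ℝ) {A : ℝ} (hA : 0 < A) :
    Torus.kineticEnergy (A • u) ^ a * torusEnstrophy (A • u) ^ b *
        (∫ x, ‖Torus.laplacian (A • u) x‖ ^ 2) ^ e =
      A ^ (2 * (a + b + e)) * (Torus.kineticEnergy u ^ a * torusEnstrophy u ^ b *
        (∫ x, ‖Torus.laplacian u x‖ ^ 2) ^ e) := by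
  have hu1 : IsContDiff 1 u := hu.isContDiff (by exact_mod_cast le_top)
  have h2 : ∀ s : ℝ, (A ^ 2) ^ s = A ^ (2 * s) := fun s => by
    rw [← Real.rpow_two, ← Real.rpow_mul hA.le]
  rw [kineticEnergy_const_smul u A, torusEnstrophy_const_smul hu1 A,
    laplacianNormSq_const_smul hu A, Real.mul_rpow (sq_nonneg A) (Torus.kineticEnergy_nonneg u),
    Real.mul_rpow (sq_nonneg A) (torusEnstrophy_nonneg u),
    Real.mul_rpow (sq_nonneg A) (laplacianNormSq_nonneg u), h2 a, h2 b, h2 e,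
    show 2 * (a + b + e) = 2 * a + 2 * b + 2 * e by ring, Real.rpow_add hA, Real.rpow_add hA]
  ring

/-- **The amplitude half-space of the monomial class.** For all real `a, b, e` with
`a + b + e < 3/2` and every viscosity-dependent constant `C(ν)`, the candidate
`dℰ/dt ≤ C(ν) K^a ℰ^b D^e` FAILS along some zero-mean classical solution of unforced
Navier–Stokes on `T³` (amplitude degree `2(a + b + e) < 3`;
`not_isRateBudget_torusEnstrophy_subcubic` at `ν = 1`). With
`not_isRateBudget_torusEnstrophy_monomial` (`b − a + 3e < 3`, the SCALING half-space,
`MonomialBudgetRefutation.lean`: planted concentrating bumps) the monomial class is now decided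
outside the wedge `{b − a + 3e ≥ 3} ∩ {a + b + e ≥ 3/2}`; e.g. `ℰ³/K²`
(`(a, b, e) = (−2, 3, 0)`: scaling degree `5`, amplitude degree `2`) is refuted here, by one
trigonometric polynomial, and is invisible to the scaling sieve. [folklore] -/
theorem not_isRateBudget_torusEnstrophy_monomial_amp (a b e : ℝ) (habe : a + b + e < 3 / 2)
    (Cν : ℝ → ℝ) :
    ¬ IsRateBudget (d := Fin 3) torusEnstrophy (fun ν v =>
      Cν ν * Torus.kineticEnergy v ^ a * torusEnstrophy v ^ b *
        (∫ x, ‖Torus.laplacian v x‖ ^ 2) ^ e) := by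
  refine not_isRateBudget_torusEnstrophy_subcubic (q := 2 * (a + b + e)) one_pos
    (fun u hu _ _ => ?_) (by linarith)
  set M : ℝ := Torus.kineticEnergy u ^ a * torusEnstrophy u ^ b *
    (∫ x, ‖Torus.laplacian u x‖ ^ 2) ^ e with hM
  refine ⟨|Cν 1 * M|, fun A hA => ?_⟩
  have hA0 : 0 < A := by linarith
  have hq0 : 0 < A ^ (2 * (a + b + e)) := Real.rpow_pos_of_pos hA0 _
  have key : Cν 1 * Torus.kineticEnergy (A • u) ^ a * torusEnstrophy (A • u) ^ b *
      (∫ x, ‖Torus.laplacian (A • u) x‖ ^ 2) ^ e = Cν 1 * M * A ^ (2 * (a + b + e)) := by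
    rw [mul_assoc (Cν 1), mul_assoc (Cν 1), monomialBudget_const_smul hu a b e hA0, hM]
    ring
  show Cν 1 * Torus.kineticEnergy (A • u) ^ a * torusEnstrophy (A • u) ^ b *
      (∫ x, ‖Torus.laplacian (A • u) x‖ ^ 2) ^ e ≤ |Cν 1 * M| * A ^ (2 * (a + b + e))
  rw [key]
  exact mul_le_mul_of_nonneg_right (le_abs_self _) hq0.le

/-- **The critical line for the enstrophy is a static inequality (door D2 for `ℰ`).** If `ℰ`
obeys a rate budget `B` along every zero-mean classical solution on `T³` and, for some `ν > 0`,
`B ν (A • u) ≤ A³ · Btop u + C_u · A^q` (`A ≥ 1`, `q < 3`) at every smooth divergence-free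
zero-mean `u`, then `σ(u₀) ≤ Btop u₀` at every such `u₀`: a budget of cubic amplitude growth
(`ℰ^{3/2}`, `(Kℰ)^{3/4}`, `K^{1/2}ℰ`, `ℰ^{3/4}P^{3/4}`, …) closes the enstrophy estimate only if
its top part bounds the production pointwise on data, with viscosity gone. [folklore] -/
theorem enstrophyProduction_le_of_isRateBudget_cubic (hd : Fintype.card d = 3)
    {B : ℝ → (UnitAddTorus d → EuclideanSpace ℝ d) → ℝ}
    {Btop : (UnitAddTorus d → EuclideanSpace ℝ d) → ℝ} {q : ℝ}
    (hB : IsRateBudget (d := d) torusEnstrophy B) {ν : ℝ} (hν : 0 < ν)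
    (hBq : ∀ u : UnitAddTorus d → EuclideanSpace ℝ d, IsSmooth u → IsDivFree u → HasZeroMean u →
      ∃ C : ℝ, ∀ A : ℝ, 1 ≤ A → B ν (A • u) ≤ A ^ 3 * Btop u + C * A ^ q)
    (hq : q < 3) {u₀ : UnitAddTorus d → EuclideanSpace ℝ d} (hu₀ : IsSmooth u₀)
    (hdiv : IsDivFree u₀) (hmean : HasZeroMean u₀) : enstrophyProduction u₀ ≤ Btop u₀ :=
  inertialRate_le_of_isRateBudget_critical (m := 2) (q := q) hB torusEnstrophy_hasInitialRate hd
    (fun A u _ hu => enstrophyViscousRate_amp hu A) (fun A u _ hu => enstrophyProduction_amp hu A)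
    hν (fun u hu hdv hmn => by
      obtain ⟨C, hC⟩ := hBq u hu hdv hmn
      refine ⟨C, fun A hA => ?_⟩
      rw [show (2 : ℝ) + 1 = ((3 : ℕ) : ℝ) by norm_num, Real.rpow_natCast]
      exact hC A hA)
    (by norm_num; exact hq) hu₀ hdiv hmean

end Summit.NavierStokesRegularity.FunctionalMining

end
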